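import Mathlib
import Literature.Computability.AlgebraicComplexity.RazTildeBlocks
import Literature.Computability.Complexity.KWProtocol
import Literature.Computability.Complexity.KWProtocolBounds
import Literature.Computability.Complexity.KWProtocolFormula
import HarnessLib

/-!
# Crux `ShallowShadows.ShadowFormulaTransfer` (stmt-ValiantsHypothesis-17124), line `Sketch` —
# the registered stub `stub_affineCoverShallow` (Fourier-lift calibration: affine covers are shallow)

For `𝒜 ⊆ {0,1}ⁿ` the LIFT `P_𝒜 = Σ_{a ∈ 𝒜} Π_i X_{(i, a_i)} ∈ ℂ[X_q : q ∈ Fin n × Bool]` has the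
SHADOW `B(x) = [∃ m ∈ supp P_𝒜, supp m ⊆ {q | x q}] = [∃ a ∈ 𝒜, ∀ i, x (i, a_i) = 1]`, box-SAT
of `𝒜` (`shadow_boxLift_iff`). If `𝒜` is the union of `k ≤ M` affine subspaces of `𝔽₂ⁿ`, each cut
out by `≤ D` parity constraints, the monotone Karchmer–Wigderson game of `B` has a protocol of
depth `⌈log₂ k⌉ + D + 2⌈log₂ n⌉ + 2` (`exists_kwTree_boxSat`): Alice fixes `a ∈ 𝒜` in her box
and a piece `V_j ∋ a`; Bob reports whether his box has an empty block `{(i,0), (i,1)}` (then he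
names `i`, Alice answers `a_i`); otherwise each coordinate of Bob's box is free or forced to
`c_i`, no point of `V_j` agrees with `c` on the forced ones, so (Fredholm alternative over `𝔽₂`
by elimination of the free coordinates, `fredholm_zmod_two`) some sub-collection `S` of the
constraints of `V_j` has odd support `P` inside the forced coordinates and
`Σ_{i∈P} a_i = Σ_{(Q,β)∈S} β ≠ Σ_{i∈P} c_i`; Alice names `j`, Bob names `S` (`D` bits), and a
parity binary search on `P` (`exists_kwTree_paritySearch`, `2⌈log₂ n⌉ + 1` bits) ends at a
forced `i` with `a_i ≠ c_i`: `x_A (i, a_i) = 1`, `x_B (i, a_i) = 0`. By "protocol ⟹ formula"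
(`KWTree.formulaSizeOver_le_two_pow_depth`) and `2^⌈log₂ x⌉ ≤ 2x + 1` the monotone formula size
of `B` is `≤ (M+1) · 2^(8D) · (n+2)^8` (`stub_affineCoverShallow`, `K = 8`).

## References

* [KarchmerWigderson1990] M. Karchmer, A. Wigderson, *Monotone circuits for connectivity require
  super-logarithmic depth*, SIAM J. Discrete Math. 3 (1990) 255–265, §2.
* [JuknaBFC2012] S. Jukna, *Boolean Function Complexity* (2012), §3.3.
-/

-- Sub = Summit single-conjunct layout: the duplicated namespace component is mandated by the tree.
set_option linter.dupNamespace false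

noncomputable section

namespace Summit.ValiantsHypothesis.ValiantsHypothesis.Theorems.ShallowShadowsShadowFormulaTransfer

open Literature.Computability.AlgebraicComplexity Literature.Computability.Complexity
open MvPolynomial

/-- **The shadow of a lift is box-SAT.** The lift `Σ_{a ∈ 𝒜} Π_i X_{(i, a_i)}` is a sum of the
monomials `e_a = Σ_i 1_{(i, a_i)}` with positive integer coefficients; `supp e_a = {(i, a_i)}`.
So its shadow holds at `x` iff some `a ∈ 𝒜` has all `x (i, a_i) = 1`. [folklore] -/
theorem shadow_boxLift_iff {n : ℕ} (𝒜 : Finset (Fin n → Bool)) (x : Fin n × Bool → Bool) :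
    (∃ m ∈ (∑ a ∈ 𝒜, ∏ i : Fin n, (X (i, a i) : MvPolynomial (Fin n × Bool) ℂ)).support,
        ∀ q ∈ m.support, x q = true) ↔ ∃ a ∈ 𝒜, ∀ i, x (i, a i) = true := by
  classical
  have hprod : ∀ a : Fin n → Bool, (∏ i : Fin n, (X (i, a i) : MvPolynomial (Fin n × Bool) ℂ)) =
      monomial (∑ i, Finsupp.single (i, a i) 1) 1 := fun a => by rw [monomial_sum_one]; rfl
  have hcoeff : ∀ (a : Fin n → Bool) (i : Fin n),
      (∑ i', Finsupp.single (i', a i') 1 : Fin n × Bool →₀ ℕ) (i, a i) = 1 := fun a i => by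
    rw [Finsupp.finsetSum_apply, Finset.sum_eq_single i (fun i' _ hi' =>
      Finsupp.single_eq_of_ne' fun h => hi' (Prod.mk.inj h).1) (by simp), Finsupp.single_eq_same]
  have hsupp : ∀ (a : Fin n → Bool) (q : Fin n × Bool),
      q ∈ (∑ i', Finsupp.single (i', a i') 1 : Fin n × Bool →₀ ℕ).support → q = (q.1, a q.1) :=
      fun a q hq => by
    rw [Finsupp.mem_support_iff, Finsupp.finsetSum_apply] at hq
    obtain ⟨i, -, hi⟩ := Finset.exists_ne_zero_of_sum_ne_zero hq
    exact (Finsupp.single_apply_ne_zero.mp hi).1 ▸ rfl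
  simp_rw [mem_support_iff, coeff_sum, hprod, coeff_monomial]
  constructor
  · rintro ⟨m, hm, hx⟩
    obtain ⟨a, ha, hne⟩ := Finset.exists_ne_zero_of_sum_ne_zero hm
    rw [Ne, ite_eq_right_iff, Classical.not_imp] at hne
    refine ⟨a, ha, fun i => hx _ ?_⟩
    rw [← hne.1, Finsupp.mem_support_iff, hcoeff]
    exact one_ne_zero
  · rintro ⟨a, ha, hx⟩
    refine ⟨∑ i', Finsupp.single (i', a i') 1, ?_, fun q hq => hsupp a q hq ▸ hx q.1⟩
    rw [Finset.sum_boole, Nat.cast_ne_zero]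
    exact Finset.card_ne_zero_of_mem (Finset.mem_filter.mpr ⟨ha, rfl⟩)

/-- **Fredholm alternative over `𝔽₂`, elimination form.** Given parity constraints
`Σ_{i ∈ Q p} a_i = β_p` (`p ∈ T`) and prescribed values `c_i` off a set `G` of free coordinates,
EITHER some `a` agreeing with `c` off `G` satisfies all constraints, OR some `𝔽₂`-combination
`w` of the constraints has even multiplicity at every free coordinate and total defect
`Σ_p w_p (Σ_{i ∈ Q p} c_i + β_p) = 1`. Induction on `G` (eliminate a free coordinate). [folklore] -/
theorem fredholm_zmod_two {α κ : Type*} [DecidableEq α] [DecidableEq κ] (T : Finset κ)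
    (Q : κ → Finset α) (β : κ → ZMod 2) (G : Finset α) :
    ∀ c : α → ZMod 2,
      (∃ a : α → ZMod 2, (∀ i, i ∉ G → a i = c i) ∧ ∀ p ∈ T, ∑ i ∈ Q p, a i = β p) ∨
      ∃ w : κ → ZMod 2, (∀ i ∈ G, (∑ p ∈ T, w p * (if i ∈ Q p then 1 else 0)) = 0) ∧
        ∑ p ∈ T, w p * (∑ i ∈ Q p, c i + β p) = 1 := by
  have ne01 : ∀ z : ZMod 2, z ≠ 0 ↔ z = 1 := by decide
  refine Finset.induction_on G (fun c => ?_) fun i₀ G _ ih c => ?_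
  · by_cases hc : ∀ p ∈ T, ∑ i ∈ Q p, c i = β p
    · exact Or.inl ⟨c, fun _ _ => rfl, hc⟩
    push Not at hc
    obtain ⟨p, hp, hne⟩ := hc
    refine Or.inr ⟨fun q => if q = p then 1 else 0, fun i hi => absurd hi (Finset.notMem_empty i),
      ?_⟩
    simp only [boole_mul, Finset.sum_ite_eq', if_pos hp]
    exact (show ∀ u v : ZMod 2, u ≠ v → u + v = 1 by decide) _ _ hne
  · rcases ih c with ⟨a, haG, haT⟩ | ⟨w₀, hw₀G, hw₀⟩
    · exact Or.inl ⟨a, fun i hi => haG i fun h => hi (Finset.mem_insert_of_mem h), haT⟩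
    by_cases hm₀ : (∑ p ∈ T, w₀ p * (if i₀ ∈ Q p then 1 else 0 : ZMod 2)) = 0
    · refine Or.inr ⟨w₀, fun i hi => ?_, hw₀⟩
      rcases Finset.mem_insert.mp hi with rfl | hi
      exacts [hm₀, hw₀G i hi]
    -- flip `c` at `i₀`
    rcases ih (fun i => c i + if i = i₀ then 1 else 0) with ⟨a, haG, haT⟩ | ⟨w₁, hw₁G, hw₁⟩
    · refine Or.inl ⟨a, fun i hi => ?_, haT⟩
      rw [haG i fun h => hi (Finset.mem_insert_of_mem h),
        if_neg fun h => hi (by rw [h]; exact Finset.mem_insert_self i₀ G), add_zero]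
    have hsplit : (∑ p ∈ T, w₁ p * (∑ i ∈ Q p, c i + β p)) +
        ∑ p ∈ T, w₁ p * (if i₀ ∈ Q p then 1 else 0 : ZMod 2) = 1 := by
      rw [← Finset.sum_add_distrib]
      refine Eq.trans (Finset.sum_congr rfl fun p _ => ?_) hw₁
      rw [Finset.sum_add_distrib, Finset.sum_ite_eq' (Q p) i₀ fun _ => (1 : ZMod 2)]
      ring
    by_cases hm₁ : (∑ p ∈ T, w₁ p * (if i₀ ∈ Q p then 1 else 0 : ZMod 2)) = 0
    · refine Or.inr ⟨w₁, fun i hi => ?_, by rwa [hm₁, add_zero] at hsplit⟩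
      rcases Finset.mem_insert.mp hi with rfl | hi
      exacts [hm₁, hw₁G i hi]
    · refine Or.inr ⟨w₀ + w₁, fun i hi => ?_, ?_⟩ <;>
        simp only [Pi.add_apply, add_mul, Finset.sum_add_distrib]
      · rcases Finset.mem_insert.mp hi with rfl | hi
        · rw [(ne01 _).mp hm₀, (ne01 _).mp hm₁]
          decide
        · rw [hw₀G i hi, hw₁G i hi, add_zero]
      · rw [(ne01 _).mp hm₁] at hsplit
        rwa [hw₀, add_comm]

/-- Over `𝔽₂`, a double sum `Σ_{p ∈ S} Σ_{i ∈ Q p} f i` is the sum of `f` over the coordinates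
of odd multiplicity (the `𝔽₂`-sum of the sets `Q p`). [folklore] -/
theorem sum_sum_eq_sum_filter_odd {α κ : Type*} [Fintype α] [DecidableEq α] (S : Finset κ)
    (Q : κ → Finset α) (f : α → ZMod 2) :
    ∑ p ∈ S, ∑ i ∈ Q p, f i =
      ∑ i ∈ Finset.univ.filter (fun i => (∑ p ∈ S, if i ∈ Q p then (1 : ZMod 2) else 0) = 1),
        f i := by
  rw [Finset.sum_filter]
  calc ∑ p ∈ S, ∑ i ∈ Q p, f i = ∑ p ∈ S, ∑ i, if i ∈ Q p then f i else 0 :=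
        Finset.sum_congr rfl fun p _ => by rw [Finset.sum_ite_mem, Finset.univ_inter]
    _ = ∑ i, ∑ p ∈ S, if i ∈ Q p then f i else 0 := Finset.sum_comm
    _ = ∑ i, (∑ p ∈ S, if i ∈ Q p then (1 : ZMod 2) else 0) * f i :=
        Finset.sum_congr rfl fun i _ => by
          rw [Finset.sum_mul]
          exact Finset.sum_congr rfl fun p _ => (boole_mul _ _).symm
    _ = _ := Finset.sum_congr rfl fun i _ => by
        rcases (by decide : ∀ z : ZMod 2, z = 0 ∨ z = 1)
          (∑ p ∈ S, if i ∈ Q p then (1 : ZMod 2) else 0) with h | h <;> simp [h]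

/-- **Parity binary search** (protocol form). Alice reads `A x : α → Bool` off her input, Bob
`C y` off his; if their parities over a list `L` of length `≤ 2^d` differ, then `2d + 1` rounds
find a position `i ∈ L` with `A x i ≠ C y i`, ending in the leaf `out i (A x i)`: both announce
their parity on the first half and recurse into a half where the parities still differ; at a
single position Alice announces her bit. [folklore] -/
theorem exists_kwTree_paritySearch {ι α : Type*} [Nonempty ι] (A C : (ι → Bool) → α → Bool)
    (out : α → Bool → ι) :
    ∀ (d : ℕ) (L : List α), L.length ≤ 2 ^ d → ∃ T : KWTree ι, T.depth ≤ 2 * d + 1 ∧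
      ∀ x y : ι → Bool,
        (L.map fun i => if A x i then (1 : ZMod 2) else 0).sum ≠
          (L.map fun i => if C y i then (1 : ZMod 2) else 0).sum →
        ∃ i ∈ L, A x i ≠ C y i ∧ T.run x y = out i (A x i) := by
  intro d
  induction d with
  | zero =>
    intro L hL
    rcases L with _ | ⟨i, _ | ⟨j, L⟩⟩
    · exact ⟨.leaf (Classical.arbitrary ι), by simp, fun x y hne => absurd rfl hne⟩
    · refine ⟨.alice (fun x => A x i) (.leaf (out i false)) (.leaf (out i true)), by simp,
        fun x y hne => ⟨i, List.mem_singleton_self i, fun heq => hne (by simp [heq]), ?_⟩⟩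
      cases hA : A x i <;> simp [hA]
    · simp at hL
  | succ d ih =>
    intro L hL
    by_cases hshort : L.length ≤ 2 ^ d
    · exact (ih L hshort).imp fun T hT => ⟨by omega, hT.2⟩
    obtain ⟨T₁, hT₁, hrun₁⟩ := ih (L.take (2 ^ d)) (by simp)
    obtain ⟨T₂, hT₂, hrun₂⟩ := ih (L.drop (2 ^ d)) (by simp; rw [pow_succ] at hL; omega)
    -- both announce their parity on the first half
    let sA : (ι → Bool) → Bool := fun x =>
      decide (((L.take (2 ^ d)).map fun i => if A x i then (1 : ZMod 2) else 0).sum = 1)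
    let sB : (ι → Bool) → Bool := fun y =>
      decide (((L.take (2 ^ d)).map fun i => if C y i then (1 : ZMod 2) else 0).sum = 1)
    refine ⟨.alice sA (.bob sB T₂ T₁) (.bob sB T₁ T₂),
      by simp only [KWTree.depth_alice, KWTree.depth_bob]; omega, fun x y hne => ?_⟩
    have hsplit : ∀ f : α → ZMod 2, (L.map f).sum =
        ((L.take (2 ^ d)).map f).sum + ((L.drop (2 ^ d)).map f).sum := fun f => by
      rw [← List.sum_append, ← List.map_append, List.take_append_drop]
    by_cases h₁ : ((L.take (2 ^ d)).map fun i => if A x i then (1 : ZMod 2) else 0).sum =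
        ((L.take (2 ^ d)).map fun i => if C y i then (1 : ZMod 2) else 0).sum
    · -- same parity on the first half: continue in the second half
      obtain ⟨i, hi, hne', hrun⟩ := hrun₂ x y fun heq => hne (by rw [hsplit, hsplit, h₁, heq])
      refine ⟨i, List.mem_of_mem_drop hi, hne', ?_⟩
      have hs : sA x = sB y := by simp only [sA, sB, h₁]
      simp only [KWTree.run_alice, KWTree.run_bob, hs]
      cases sB y <;> simpa using hrun
    · -- different parity on the first half: continue there
      obtain ⟨i, hi, hne', hrun⟩ := hrun₁ x y h₁
      refine ⟨i, List.mem_of_mem_take hi, hne', ?_⟩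
      have hs : sA x = !sB y :=
        (show ∀ u v : ZMod 2, u ≠ v → decide (u = 1) = !decide (v = 1) by decide) _ _ h₁
      simp only [KWTree.run_alice, KWTree.run_bob, hs]
      cases sB y <;> simpa using hrun

/-- **The box-SAT protocol.** Let `𝒜 ⊆ {0,1}ⁿ` be the union of the affine subspaces
`V_j = {a | ∀ (Q, β) ∈ H j, Σ_{i ∈ Q} a_i = β}` (`j < k`, `#(H j) ≤ D`) and `h` (any spelling of)
box-SAT of `𝒜`: `h x ⇔ ∃ a ∈ 𝒜, ∀ i, x (i, a_i)`. The monotone Karchmer–Wigderson game of `h`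
has a protocol of depth `≤ ⌈log₂ k⌉ + D + 2⌈log₂ n⌉ + 2`: Bob reports an empty block (he names
`i`, Alice answers `a_i`), or Alice names her piece `j`, Bob a combination `S ⊆ H j` of its
constraints with odd support inside his forced coordinates, violated by his forced values
(`fredholm_zmod_two`), and a parity binary search on the odd support finds a forced `i` with
`a_i ≠ c_i`. [folklore] -/
theorem exists_kwTree_boxSat {n k D : ℕ} (hn : 0 < n) (𝒜 : Finset (Fin n → Bool))
    (H : Fin k → Finset (Finset (Fin n) × Bool)) (hD : ∀ j, (H j).card ≤ D)
    (hcov : ∀ a : Fin n → Bool, a ∈ 𝒜 ↔ ∃ j, ∀ p ∈ H j,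
      (∑ i ∈ p.1, (if a i then (1 : ZMod 2) else 0)) = (if p.2 then 1 else 0))
    (h : (Fin n × Bool → Bool) → Bool) (hh : ∀ x, h x = true ↔ ∃ a ∈ 𝒜, ∀ i, x (i, a i) = true) :
    ∃ P : KWTree (Fin n × Bool), P.SolvesMono h ∧
      P.depth ≤ Nat.clog 2 k + D + 2 * Nat.clog 2 n + 2 := by
  classical
  haveI : Nonempty (Fin n × Bool) := ⟨(⟨0, hn⟩, false)⟩
  have z01 : ∀ z : ZMod 2, z = 0 ∨ z = 1 := by decide
  have hnt : n ≤ 2 ^ Nat.clog 2 n := Nat.le_pow_clog one_lt_two n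
  -- Alice's point `A x ∈ 𝒜` inside her box (Bob's forced values are `i ↦ y (i, 1)`)
  let A : (Fin n × Bool → Bool) → Fin n → Bool := fun x =>
    if hx : ∃ a ∈ 𝒜, ∀ i, x (i, a i) = true then Classical.choose hx else fun _ => false
  have hA : ∀ x, h x = true → A x ∈ 𝒜 ∧ ∀ i, x (i, A x i) = true := fun x hx => by
    simp only [A, dif_pos ((hh x).mp hx)]
    exact Classical.choose_spec ((hh x).mp hx)
  -- numberings of coordinates / pieces / sub-collections of a piece; odd supports
  let idx : ℕ → Fin n := fun l => if hl : l < n then ⟨l, hl⟩ else ⟨0, hn⟩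
  let H' : ℕ → Finset (Finset (Fin n) × Bool) := fun j => if hj : j < k then H ⟨j, hj⟩ else ∅
  let Sdec : ℕ → ℕ → Finset (Finset (Fin n) × Bool) := fun j l =>
    if hl : l < (H' j).powerset.card then ((H' j).powerset.equivFin.symm ⟨l, hl⟩ : Finset _)
    else ∅
  let Δ : ℕ → ℕ → Finset (Fin n) := fun j l =>
    Finset.univ.filter fun i => (∑ p ∈ Sdec j l, if i ∈ p.1 then (1 : ZMod 2) else 0) = 1
  -- the parity binary search trees on the odd supports
  have hBS := fun j l => exists_kwTree_paritySearch A (fun y i => y (i, true)) Prod.mk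
    (Nat.clog 2 n) (Δ j l).toList
    (by rw [Finset.length_toList]; exact ((Δ j l).card_le_univ).trans (by simpa using hnt))
  choose BST hBSTd hBSTrun using hBS
  -- Alice's piece number; Bob's violated combinations and their number; Bob's empty block
  let cA : (Fin n × Bool → Bool) → ℕ := fun x =>
    if hx : ∃ j : Fin k, ∀ p ∈ H j, (∑ i ∈ p.1, (if A x i then (1 : ZMod 2) else 0)) =
      (if p.2 then 1 else 0) then (Classical.choose hx).val else 0
  let good : ℕ → Finset (Finset (Fin n) × Bool) → (Fin n × Bool → Bool) → Prop := fun j S y =>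
    S ∈ (H' j).powerset ∧
      (∀ i : Fin n, y (i, false) = true ∧ y (i, true) = true →
        (∑ p ∈ S, if i ∈ p.1 then (1 : ZMod 2) else 0) = 0) ∧
      (∑ p ∈ S, ((∑ i ∈ p.1, if y (i, true) then (1 : ZMod 2) else 0) +
        if p.2 then 1 else 0)) = 1
  let cB : ℕ → (Fin n × Bool → Bool) → ℕ := fun j y =>
    if hy : ∃ S, good j S y then
      ((H' j).powerset.equivFin ⟨Classical.choose hy, (Classical.choose_spec hy).1⟩ : ℕ) else 0
  let cE : (Fin n × Bool → Bool) → ℕ := fun y =>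
    if hy : ∃ i : Fin n, y (i, false) = false ∧ y (i, true) = false then
      (Classical.choose hy).val else 0
  refine ⟨.bob (fun y => decide (∃ i : Fin n, y (i, false) = false ∧ y (i, true) = false))
      (KWTree.aliceChoose (Nat.clog 2 k) cA fun j => KWTree.bobChoose D (cB j) (BST j))
      (KWTree.bobChoose (Nat.clog 2 n) cE fun l =>
        .alice (fun x => A x (idx l)) (.leaf (idx l, false)) (.leaf (idx l, true))), ?_, ?_⟩
  swap
  · -- depth
    have h1 := KWTree.depth_aliceChoose_le (Nat.clog 2 k) cA
      (fun j => KWTree.bobChoose D (cB j) (BST j)) _ fun j _ =>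
        KWTree.depth_bobChoose_le _ _ _ _ fun l _ => hBSTd j l
    have h2 := KWTree.depth_bobChoose_le (Nat.clog 2 n) cE (fun l => KWTree.alice
      (fun x => A x (idx l)) (.leaf (idx l, false)) (.leaf (idx l, true))) 1 fun l _ => by simp
    simp only [KWTree.depth_bob]; omega
  intro x y hx hy
  obtain ⟨hA𝒜, hAx⟩ := hA x hx
  have hy' : ∀ a ∈ 𝒜, ∃ i, y (i, a i) = false := fun a ha => by
    by_contra hcon
    push Not at hcon
    have h' := (hh y).mpr ⟨a, ha, fun i => by simpa using hcon i⟩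
    simp [hy] at h'
  simp only [KWTree.run_bob]
  by_cases hs : ∃ i : Fin n, y (i, false) = false ∧ y (i, true) = false
  · -- PHASE 1: Bob names an empty block `i`, Alice answers `a i`
    have hcE : cE y = (Classical.choose hs).val := by simp only [cE]; rw [dif_pos hs]
    have hidx : idx (cE y) = Classical.choose hs := by
      rw [hcE]; simp only [idx]; rw [dif_pos (Classical.choose hs).isLt]
    rw [if_pos (decide_eq_true hs),
      KWTree.run_bobChoose _ cE _ x y (by rw [hcE]; exact (Fin.isLt _).trans_le hnt)]
    obtain ⟨h0, h1⟩ := Classical.choose_spec hs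
    have hxa := hAx (Classical.choose hs)
    simp only [KWTree.run_alice, KWTree.run_leaf, hidx]
    cases hAi : A x (Classical.choose hs) <;> rw [hAi] at hxa <;> simp [hxa, h0, h1]
  -- PHASE 2: no empty block. Alice names her piece `j₀`
  rw [decide_eq_false hs, if_neg Bool.false_ne_true]
  have hxj := (hcov (A x)).mp hA𝒜
  have hj₀ := Classical.choose_spec hxj
  have hcA : cA x = (Classical.choose hxj).val := by simp only [cA]; rw [dif_pos hxj]
  have hH' : H' (cA x) = H (Classical.choose hxj) := by
    rw [hcA]; simp only [H']; rw [dif_pos (Classical.choose hxj).isLt]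
  rw [KWTree.run_aliceChoose _ cA _ x y
    (by rw [hcA]; exact (Fin.isLt _).trans_le (Nat.le_pow_clog one_lt_two k))]
  -- Bob names a violated combination `S ⊆ H j₀` (Fredholm alternative)
  have hgood : ∃ S, good (cA x) S y := by
    rcases fredholm_zmod_two (H (Classical.choose hxj)) Prod.fst (fun p => if p.2 then 1 else 0)
        (Finset.univ.filter fun i : Fin n => y (i, false) = true ∧ y (i, true) = true)
        (fun i => if y (i, true) then 1 else 0) with ⟨a', ha'G, ha'T⟩ | ⟨w, hwG, hw⟩
    · -- a point of the piece agreeing with Bob's forced values would lie in Bob's box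
      exfalso
      have hbz : ∀ i, (if decide (a' i = 1) = true then (1 : ZMod 2) else 0) = a' i :=
        fun i => by rcases z01 (a' i) with h | h <;> simp [h]
      obtain ⟨i, hi⟩ := hy' (fun i => decide (a' i = 1))
        ((hcov _).mpr ⟨_, fun p hp => by simp only [hbz]; exact ha'T p hp⟩)
      have hG : y (i, false) = false ∨ y (i, true) = false →
          a' i = if y (i, true) then 1 else 0 := fun h' => ha'G i (by
        rcases h' with h' | h' <;> simp [h'])
      rcases z01 (a' i) with h0 | h1
      · simp [h0] at hi
        cases hyt : y (i, true)
        · exact hs ⟨i, hi, hyt⟩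
        · simpa [hyt, h0] using hG (Or.inl hi)
      · simp [h1] at hi
        simpa [hi, h1] using hG (Or.inr hi)
    · refine ⟨(H (Classical.choose hxj)).filter fun p => w p = 1,
        by rw [hH']; exact Finset.mem_powerset.mpr (Finset.filter_subset _ _),
        fun i hi => ?_, ?_⟩ <;> rw [Finset.sum_filter]
      · refine Eq.trans (Finset.sum_congr rfl fun p _ => ?_) (hwG i (by simpa using hi))
        rcases z01 (w p) with h | h <;> simp [h]
      · refine Eq.trans (Finset.sum_congr rfl fun p _ => ?_) hw
        rcases z01 (w p) with h | h <;> simp [h]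
  obtain ⟨hSpow, hSfree, hSone⟩ := Classical.choose_spec hgood
  have hcB : cB (cA x) y = ((H' (cA x)).powerset.equivFin ⟨_, hSpow⟩ : ℕ) := by
    simp only [cB]; rw [dif_pos hgood]
  have hcBlt : cB (cA x) y < (H' (cA x)).powerset.card := by rw [hcB]; exact Fin.isLt _
  have hSdec : Sdec (cA x) (cB (cA x) y) = Classical.choose hgood := by
    simp only [Sdec]
    rw [dif_pos hcBlt, show (⟨_, hcBlt⟩ : Fin _) = _ from Fin.ext hcB, Equiv.symm_apply_apply]
  rw [KWTree.run_bobChoose D _ _ x y (hcBlt.trans_le (by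
    rw [Finset.card_powerset, hH']; exact Nat.pow_le_pow_right two_pos (hD _)))]
  -- the parities of `A x` and of Bob's forced values on the odd support `Δ` of `S` differ
  have hSsub : Classical.choose hgood ⊆ H (Classical.choose hxj) :=
    Finset.mem_powerset.mp (hH' ▸ hSpow)
  obtain ⟨i, hiL, hne, hrun⟩ := hBSTrun (cA x) (cB (cA x) y) x y (by
    rw [Finset.sum_map_toList, Finset.sum_map_toList]
    simp only [Δ, hSdec]
    rw [← sum_sum_eq_sum_filter_odd, ← sum_sum_eq_sum_filter_odd,
      Finset.sum_congr rfl fun p hp => hj₀ p (hSsub hp)]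
    intro heq
    rw [Finset.sum_add_distrib, ← heq] at hSone
    exact (show ∀ u : ZMod 2, u + u ≠ 1 by decide) _ hSone)
  rw [hrun]
  refine ⟨hAx i, ?_⟩
  -- `i ∈ Δ` is forced (odd multiplicity), to the value `y (i, 1) ≠ A x i`
  have hi : ¬ (y (i, false) = true ∧ y (i, true) = true) := fun hG => by
    have := Finset.mem_toList.mp hiL
    simp only [Δ, hSdec, Finset.mem_filter, hSfree i hG] at this
    exact zero_ne_one this.2
  cases hAi : A x i <;> rw [hAi] at hne
  · have hyt : y (i, true) = true := by simpa using hne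
    simpa [hyt] using hi
  · simpa using hne

/-- **Stub `AffineCoverShallow`** (registered stub `stub_affineCoverShallow` of line `Sketch`,
crux stmt-ValiantsHypothesis-17124; Fourier-lift calibration): if `𝒜 ⊆ {0,1}ⁿ` is the union of
`k ≤ M` affine subspaces over `𝔽₂`, the `j`-th cut out by the `≤ D` parity constraints `H j`,
then the shadow of the lift `Σ_{a ∈ 𝒜} Π_i X_{(i, a_i)}` — box-SAT of `𝒜` (`shadow_boxLift_iff`) —
has monotone formula size `≤ (M+1) · 2^(8D) · (n+2)^8`: the protocol of `exists_kwTree_boxSat`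
has depth `d ≤ ⌈log₂ k⌉ + D + 2⌈log₂ n⌉ + 2`, which gives a monotone formula of size `≤ 2^d`
(`KWTree.formulaSizeOver_le_two_pow_depth`), and `2^⌈log₂ x⌉ ≤ 2x + 1`. (For `n = 0` the
shadow is constant: junk value `0`.) [cite: KarchmerWigderson1990, §2] -/
theorem stub_affineCoverShallow :
    ∃ K : ℕ, ∀ (n M D : ℕ) (𝒜 : Finset (Fin n → Bool)),
      (∃ (k : ℕ) (H : Fin k → Finset (Finset (Fin n) × Bool)), k ≤ M ∧ (∀ j, (H j).card ≤ D) ∧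
        ∀ a : Fin n → Bool, a ∈ 𝒜 ↔ ∃ j, ∀ p ∈ H j,
          (∑ i ∈ p.1, (if a i then (1 : ZMod 2) else 0)) = (if p.2 then 1 else 0)) →
      formulaSizeOver monotoneBasis (fun x : Fin n × Bool → Bool =>
          decide (∃ m ∈ (∑ a ∈ 𝒜, ∏ i : Fin n,
              (MvPolynomial.X (i, a i) : MvPolynomial (Fin n × Bool) ℂ)).support,
            ∀ q ∈ m.support, x q = true)) ≤ (M + 1) * 2 ^ (K * D) * (n + 2) ^ K := by
  refine ⟨8, fun n M D 𝒜 ⟨k, H, hk, hD, hcov⟩ => ?_⟩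
  rcases Nat.eq_zero_or_pos n with rfl | hn
  · -- no variables: the shadow is constant, junk value `0`
    rw [formulaSizeOver_monotoneBasis_eq_zero_of_not_nonconst]
    · exact Nat.zero_le _
    · rintro ⟨⟨x₁, h₁⟩, x₀, h₀⟩
      rw [Subsingleton.elim x₁ x₀, h₀] at h₁
      exact Bool.false_ne_true h₁
  obtain ⟨P, hP, hd⟩ := exists_kwTree_boxSat hn 𝒜 H hD hcov _
    fun x => decide_eq_true_iff.trans (shadow_boxLift_iff 𝒜 x)
  have h32 : 32 * (n + 2) ^ 2 ≤ (n + 2) ^ 8 := by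
    rw [show (n + 2) ^ 8 = (n + 2) ^ 6 * (n + 2) ^ 2 by ring]
    exact Nat.mul_le_mul_right _
      ((by norm_num : 32 ≤ 2 ^ 6).trans (Nat.pow_le_pow_left (show 2 ≤ n + 2 by omega) 6))
  calc formulaSizeOver monotoneBasis _ ≤ 2 ^ P.depth := P.formulaSizeOver_le_two_pow_depth hP
    _ ≤ 2 ^ (Nat.clog 2 k + D + 2 * Nat.clog 2 n + 2) := Nat.pow_le_pow_right two_pos hd
    _ = 2 ^ Nat.clog 2 k * 2 ^ D * (2 ^ Nat.clog 2 n) ^ 2 * 4 := by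
          rw [pow_add, pow_add, pow_add, pow_mul']; rfl
    _ ≤ (2 * k + 1) * 2 ^ D * (2 * n + 1) ^ 2 * 4 := by
          gcongr <;> exact RazBlocks.two_pow_clog_le _
    _ ≤ (2 * (M + 1)) * 2 ^ (8 * D) * (2 * (n + 2)) ^ 2 * 4 := by gcongr <;> omega
    _ = (M + 1) * 2 ^ (8 * D) * (32 * (n + 2) ^ 2) := by ring
    _ ≤ (M + 1) * 2 ^ (8 * D) * (n + 2) ^ 8 := by gcongr

end Summit.ValiantsHypothesis.ValiantsHypothesis.Theorems.ShallowShadowsShadowFormulaTransfer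

end
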